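import Literature.NumberTheory.Rogawski1990.ArchHSBallVolumeProduct      -- ★ p848675 (LH3-p03): «places multiply», `haar_hsWeight_succ_le_of_unitaryGroupOfForm`, `haar_setOf_archHSGL_endoEmbArch_le`
import Literature.NumberTheory.Rogawski1990.ArchPlaneHaarHSBallLocal     -- ★ p848722 (LH3-p02): `haar_unitaryGroupOfForm_antidiag_two_hsBall_le_linear` = «(T2-out)» unconditional
import HarnessLib

/-!
# Linear–polylog growth of the Haar volume of Hilbert–Schmidt balls in `H_∞ = (U(Φ₂) × U(Φ₁))(L⁺ ⊗ ℝ)`, UNCONDITIONAL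
# (deal #14 of the (VOL)-plumbing behind the `stub_N9` pay-down line, LH3; Beuzart-Plessis 2020 §1.5 (1.5.2)–(1.5.3))

Topic `NumberTheory/Rogawski1990`; namespace `Literature.NumberTheory.Rogawski1990`.  THEOREMS ONLY (no definition, no instance, no notation, no named fact, no
`sorry`).  Cell `pub/hodgecm-mathlib`, F0∕P3c line LH3 (crux H413 = `stmt-HodgeConjecture-24833`); seat LH3-p02 (g0), deal #14 of LH3-plan (g0) 03:34Z; lane
`--supports stmt-HodgeConjecture-24833`.  HONEST LABEL: HC_CM is proved only modulo the 7 printed citations (2 remaining: hLiu418 = stmt-HodgeConjecture-24832, h413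
= stmt-HodgeConjecture-24833) until rung 0 closes; this file is the junction of two ★ kernel files and pays no printed statement — it is the group-side input
`hgrp` of LH3-p04's elliptic (VOL) assembler ★ `quotientMeasure_ball_le_of_compact_of_comparison` (`ArchOrbitHSBallVolumeElliptic`), hence of ★ p848470 (CONV):
convergence of the orbital integrals of Harish-Chandra Schwartz functions on `H_∞` — the analytic content of the line's two remaining LETTERS O1 (Shelstad's Schwartz
transfer) and O3′ (Bouaziz's replacement).

THE MATHEMATICS.  LH3-p03's ★ `ArchHSBallVolumeProduct` proves, for every Haar measure `νH` on `H_∞`, the bound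
`νH {k ∣ ∏_w (‖k_{2,w}‖²_HS + 1) ≤ R} ≤ A · R · (1 + log R)^m` (dyadic boxes over the places `w`, ★ `archPiEquivCM`, compact `U(Φ₁)_∞`) FROM the per-place linear
growth «(T2-out)» of the Haar volume of HS-balls in `U(Φ₂)(ℂ)_w ≅ U(1,1)`, taken there as the hypothesis `hT2`; LH3-p02's ★ `ArchPlaneHaarHSBallLocal` ED. 3 proves
«(T2-out)» (through the `S¹ × SL₂(ℝ)` model and LH3-p04's ★ `SL2HSBallVolume`: `vol{‖g‖²_HS ≤ ρ} ≤ 16π ρ` in `SL₂(ℝ)`).  This file applies the one to the other.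
[BeuzartPlessis2020Asterisque, §1.5 (1.5.2)–(1.5.3) p. 31: polynomial growth of the volume of balls `{σ ≤ R}` in a real reductive group.]
* `haar_hsWeight_succ_le_archLocal_two` — per place: `ν {y ∣ Σ|y_ij|² + 1 ≤ ρ} ≤ C ρ` (`ρ ≥ 1`) for every Haar `ν` on `archLocal L 2 Φ₂ w`.
* `haar_setOf_archHSGL_endoEmbArch_le_linear` — on `H_∞`: `νH {k ∣ archHSGL L 3 (ι_∞ k) ≤ R} ≤ A · R · (1 + log R)^m` (`R ≥ 1`), the `hgrp` token shape
  `A * r * (1 + Real.log r) ^ m` of ★ `ArchOrbitHSBallVolumeElliptic`.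

## References
* [BeuzartPlessis2020Asterisque] R. Beuzart-Plessis, Astérisque 418 (2020), §1.5 (1.5.2)–(1.5.3) p. 31.
* [Borel1997] A. Borel, *Automorphic Forms on SL₂(ℝ)*, Cambridge Tracts in Math. 130 (1997), §2.3, §4.1.
-/

set_option autoImplicit false

noncomputable section

open MeasureTheory NumberField NumberField.InfinitePlace NumberField.mixedEmbedding
open Literature.NumberTheory.Automorphic Literature.NumberTheory.Automorphic.UnitaryGroup
open scoped ENNReal NNReal MatrixGroups Matrix

namespace Literature.NumberTheory.Rogawski1990

variable (L : Type) [Field L] [NumberField L] [IsCMField L]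

omit [NumberField L] [IsCMField L] in
/-- **PER PLACE, UNCONDITIONAL**: for every complex place `w` and every Haar measure `ν` on the place carrier `archLocal L 2 Φ₂ w ≅ U(1,1)`,
`ν {y ∣ Σ|y_ij|² + 1 ≤ ρ} ≤ C · ρ¹` for `ρ ≥ 1` (★ `haar_hsWeight_succ_le_of_unitaryGroupOfForm` at ★ `haar_unitaryGroupOfForm_antidiag_two_hsBall_le_linear`).
[cite: BeuzartPlessis2020Asterisque, §1.5 (1.5.2)–(1.5.3) p. 31] -/
theorem haar_hsWeight_succ_le_archLocal_two (w : {w : InfinitePlace L // w.IsComplex})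
    [MeasurableSpace ↥(archLocal L 2 (Matrix.of fun i j : Fin 2 => if i.val + j.val + 1 = 2 then (1 : L) else 0) w)]
    [BorelSpace ↥(archLocal L 2 (Matrix.of fun i j : Fin 2 => if i.val + j.val + 1 = 2 then (1 : L) else 0) w)]
    (ν : Measure ↥(archLocal L 2 (Matrix.of fun i j : Fin 2 => if i.val + j.val + 1 = 2 then (1 : L) else 0) w)) [ν.IsHaarMeasure] :
    ∃ C : ℝ, ∀ ρ : ℝ, 1 ≤ ρ →
      ν {y | ∑ i : Fin 2, ∑ j : Fin 2, ‖((y : GL (Fin 2) ℂ) : Matrix (Fin 2) (Fin 2) ℂ) i j‖ ^ 2 + 1 ≤ ρ} ≤ ENNReal.ofReal (C * ρ ^ (1 : ℝ)) :=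
  haar_hsWeight_succ_le_of_unitaryGroupOfForm L w haar_unitaryGroupOfForm_antidiag_two_hsBall_le_linear ν

/-- **ON `H_∞`, UNCONDITIONAL — the `hgrp` token of the elliptic (VOL) assembler**: for every Haar measure `νH` on
`H_∞ = U(Φ₂)(L⁺ ⊗ ℝ) × U(Φ₁)(L⁺ ⊗ ℝ)` there are `A, m` with `νH {k ∣ archHSGL L 3 (ι_∞ k) ≤ R} ≤ A · R · (1 + log R)^m` for all `R ≥ 1`
(★ `haar_setOf_archHSGL_endoEmbArch_le` at ★ «(T2-out)»; `R ^ (1 : ℝ) = R`). [cite: BeuzartPlessis2020Asterisque, §1.5 (1.5.2)–(1.5.3) p. 31] -/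
theorem haar_setOf_archHSGL_endoEmbArch_le_linear
    [MeasurableSpace (↥(UnitaryGroup.arch (↥(maximalRealSubfield L)) L (IsCMField.complexConj L) 2 (Matrix.of fun i j : Fin 2 => if i.val + j.val + 1 = 2 then (1 : L) else 0)) ×
      ↥(UnitaryGroup.arch (↥(maximalRealSubfield L)) L (IsCMField.complexConj L) 1 (Matrix.of fun i j : Fin 1 => if i.val + j.val + 1 = 1 then (1 : L) else 0)))]
    [BorelSpace (↥(UnitaryGroup.arch (↥(maximalRealSubfield L)) L (IsCMField.complexConj L) 2 (Matrix.of fun i j : Fin 2 => if i.val + j.val + 1 = 2 then (1 : L) else 0)) ×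
      ↥(UnitaryGroup.arch (↥(maximalRealSubfield L)) L (IsCMField.complexConj L) 1 (Matrix.of fun i j : Fin 1 => if i.val + j.val + 1 = 1 then (1 : L) else 0)))]
    (νH : Measure (↥(UnitaryGroup.arch (↥(maximalRealSubfield L)) L (IsCMField.complexConj L) 2 (Matrix.of fun i j : Fin 2 => if i.val + j.val + 1 = 2 then (1 : L) else 0)) ×
      ↥(UnitaryGroup.arch (↥(maximalRealSubfield L)) L (IsCMField.complexConj L) 1 (Matrix.of fun i j : Fin 1 => if i.val + j.val + 1 = 1 then (1 : L) else 0))))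
    [νH.IsHaarMeasure] :
    ∃ (A : ℝ) (m : ℕ), ∀ R : ℝ, 1 ≤ R →
      νH {k | archHSGL L 3 ((endoEmbArch L k).val : GL (Fin 3) (mixedSpace L)) ≤ R} ≤ ENNReal.ofReal (A * R * (1 + Real.log R) ^ m) := by
  obtain ⟨A, m, hA⟩ := haar_setOf_archHSGL_endoEmbArch_le L haar_unitaryGroupOfForm_antidiag_two_hsBall_le_linear νH
  refine ⟨A, m, fun R hR => ?_⟩
  have h := hA R hR
  rwa [Real.rpow_one] at h

end Literature.NumberTheory.Rogawski1990

end
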